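import Summits.QuantumFields.YangMills.Theorems.LuscherReductionTwistedTraceScalingBOCoreCurrency
import HarnessLib

/-!
# (C4-CORE γ, the shell piece in relative currency) THE DUAL-BO SHELL PIECE AS A RATE AGAINST `Λ²T`, pure algebra
# (lane A of S-BASE, crux `TwistedTraceScaling` stmt-QuantumFields-20203, C4-CORE, the (OD) pen; `pub/ym-fleet/ym-luscher-20007-p1/HANDOFF-g20.md` (γ))

The companion of `…BOCoreCurrency.core_currency` for the shell piece of `…BODefectShellB.shell_dualBO_sq_integral_le`: from the shell bound
`I ≤ N_hi·G·((Z⁻¹a₀/N̄)²·((Λ₁/K₁)²·‖φ‖²))` (`G = e^{−β·gap·R₀²}·π(univ)`), the quasimode floor `(1−η)a₀M₂in ≤ btC·K₁` (`…BOBtCFloor.btC_floor_of_quasimode`), the norm floor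
`(1−κ)γ‖φ‖² ≤ T`, `γ ≤ 2N̄M₂in` and `Λ₁ ≤ 2λ₀`:  ★★ `shell_currency` — `I ≤ (8N_hi G/((1−η)²(1−κ)M₂in N̄))·(btC·Z⁻¹/γ·λ₀)²·T`, and ★ `sq_le_of_shell_currency` — the same as
`I ≤ (b_B·Λ)²·T` with `b_B = √(8N_hi G/((1−η)²(1−κ)M₂in N̄))`.  (No knowledge of `a₀ = c₁S/D` is needed: it is eliminated exactly as in the core piece.)
HONEST FRAMING: bookkeeping for a stub of a child of the CONDITIONAL route R2b1; the hOD assembly, (B-ST), C4-CORE remain OPEN; not a gap, not Clay.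
-/

set_option autoImplicit false

noncomputable section

namespace Summit.QuantumFields.YangMills.Theorems.FemtoTransferGap.TwoLattice.ConstTube

/-- ★★ **THE SHELL PIECE IN RELATIVE CURRENCY** (see the module docstring). [cite: Luscher1983, §3] -/
theorem shell_currency {I T Zi a₀ Nhi G Nbar M2in Λ₁ K₁ φ2 btC η γ κ lam0 : ℝ}
    (hZi : 0 < Zi) (ha₀ : 0 ≤ a₀) (hNhi : 0 ≤ Nhi) (hG : 0 ≤ G) (hN : 0 < Nbar) (hM : 0 < M2in) (hK₁ : 0 < K₁) (hφ2 : 0 ≤ φ2) (hη : η < 1) (hκ : κ < 1)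
    (hγ : 0 < γ) (hΛ₁ : 0 ≤ Λ₁)
    (h1 : I ≤ Nhi * G * ((Zi * a₀ / Nbar) ^ 2 * ((Λ₁ / K₁) ^ 2 * φ2)))
    (h2 : (1 - η) * a₀ * M2in ≤ btC * K₁) (h3 : (1 - κ) * γ * φ2 ≤ T) (h4 : γ ≤ 2 * (Nbar * M2in)) (h5 : Λ₁ ≤ 2 * lam0) :
    I ≤ (8 * Nhi * G / ((1 - η) ^ 2 * (1 - κ) * M2in * Nbar)) * (btC * Zi / γ * lam0) ^ 2 * T := by
  have hη1 : 0 < 1 - η := by linarith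
  have hκ1 : 0 < 1 - κ := by linarith
  have hlam : 0 ≤ lam0 := by linarith
  have hbtC : 0 ≤ btC := by
    have h : 0 ≤ btC * K₁ := le_trans (by positivity) h2
    by_contra hneg
    push Not at hneg
    nlinarith [mul_neg_of_neg_of_pos hneg hK₁]
  have hA1 : a₀ ≤ btC * K₁ / ((1 - η) * M2in) := by
    rw [le_div_iff₀ (by positivity)]; nlinarith [h2]
  -- `(a₀Λ₁/K₁)² ≤ (2 btC λ₀/((1−η)M₂in))²`
  have hA3 : a₀ * (Λ₁ / K₁) ≤ 2 * btC * lam0 / ((1 - η) * M2in) := by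
    have h := mul_le_mul hA1 (div_le_div_of_nonneg_right h5 hK₁.le) (by positivity) (by positivity)
    calc a₀ * (Λ₁ / K₁) ≤ btC * K₁ / ((1 - η) * M2in) * (2 * lam0 / K₁) := h
      _ = 2 * btC * lam0 / ((1 - η) * M2in) := by field_simp
  have hA4 : (a₀ * (Λ₁ / K₁)) ^ 2 ≤ (2 * btC * lam0 / ((1 - η) * M2in)) ^ 2 := pow_le_pow_left₀ (by positivity) hA3 2
  -- step A: `I ≤ N_hi G Zi²/N̄² · 4btC²λ₀²/((1−η)²M₂in²) · φ2`
  have hX : Nhi * G * ((Zi * a₀ / Nbar) ^ 2 * ((Λ₁ / K₁) ^ 2 * φ2)) ≤ Nhi * G * (Zi / Nbar) ^ 2 * (2 * btC * lam0 / ((1 - η) * M2in)) ^ 2 * φ2 := by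
    have e1 : Nhi * G * ((Zi * a₀ / Nbar) ^ 2 * ((Λ₁ / K₁) ^ 2 * φ2)) = Nhi * G * (Zi / Nbar) ^ 2 * (a₀ * (Λ₁ / K₁)) ^ 2 * φ2 := by ring
    rw [e1]
    have hpre : 0 ≤ Nhi * G * (Zi / Nbar) ^ 2 := by positivity
    exact mul_le_mul_of_nonneg_right (mul_le_mul_of_nonneg_left hA4 hpre) hφ2
  -- step B: against `T ≥ (1−κ)γφ2` with `γ ≤ 2N̄M₂in`
  have hT : (1 - κ) * γ * φ2 ≤ T := h3
  have key : Nhi * G * (Zi / Nbar) ^ 2 * (2 * btC * lam0 / ((1 - η) * M2in)) ^ 2 * φ2 ≤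
      (8 * Nhi * G / ((1 - η) ^ 2 * (1 - κ) * M2in * Nbar)) * (btC * Zi / γ * lam0) ^ 2 * ((1 - κ) * γ * φ2) := by
    -- divide out the common nonnegative factor `N_hi G Zi² btC² λ₀² φ2/((1−η)² M₂in)`; it remains `4/(N̄² M₂in) ≤ 8(1−κ)γ/((1−κ) M₂in N̄ γ²) = 8/(M₂in N̄ γ)`, i.e. `γ ≤ 2N̄M₂in`
    have e1 : Nhi * G * (Zi / Nbar) ^ 2 * (2 * btC * lam0 / ((1 - η) * M2in)) ^ 2 * φ2 =
        (Nhi * G * Zi ^ 2 * btC ^ 2 * lam0 ^ 2 * φ2 / ((1 - η) ^ 2 * M2in)) * (4 / (Nbar ^ 2 * M2in)) := by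
      field_simp
      ring
    have e2 : (8 * Nhi * G / ((1 - η) ^ 2 * (1 - κ) * M2in * Nbar)) * (btC * Zi / γ * lam0) ^ 2 * ((1 - κ) * γ * φ2) =
        (Nhi * G * Zi ^ 2 * btC ^ 2 * lam0 ^ 2 * φ2 / ((1 - η) ^ 2 * M2in)) * (8 / (Nbar * γ)) := by
      field_simp
    rw [e1, e2]
    have hpre : 0 ≤ Nhi * G * Zi ^ 2 * btC ^ 2 * lam0 ^ 2 * φ2 / ((1 - η) ^ 2 * M2in) := by positivity
    refine mul_le_mul_of_nonneg_left ?_ hpre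
    rw [div_le_div_iff₀ (by positivity) (by positivity)]
    nlinarith [h4, hN, hM, hγ]
  have hb0 : 0 ≤ (8 * Nhi * G / ((1 - η) ^ 2 * (1 - κ) * M2in * Nbar)) * (btC * Zi / γ * lam0) ^ 2 := by positivity
  calc I ≤ _ := h1
    _ ≤ _ := hX
    _ ≤ _ := key
    _ ≤ (8 * Nhi * G / ((1 - η) ^ 2 * (1 - κ) * M2in * Nbar)) * (btC * Zi / γ * lam0) ^ 2 * T := mul_le_mul_of_nonneg_left hT hb0

/-- ★ The same written as `I ≤ (b_B·Λ)²·T`, `b_B = √(8N_hi G/((1−η)²(1−κ)M₂in N̄))`, `Λ = btC·Z⁻¹/γ·λ₀`. [cite: Luscher1983, §3] -/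
theorem sq_le_of_shell_currency {I T Zi a₀ Nhi G Nbar M2in Λ₁ K₁ φ2 btC η γ κ lam0 : ℝ}
    (hZi : 0 < Zi) (ha₀ : 0 ≤ a₀) (hNhi : 0 ≤ Nhi) (hG : 0 ≤ G) (hN : 0 < Nbar) (hM : 0 < M2in) (hK₁ : 0 < K₁) (hφ2 : 0 ≤ φ2) (hη : η < 1) (hκ : κ < 1)
    (hγ : 0 < γ) (hΛ₁ : 0 ≤ Λ₁)
    (h1 : I ≤ Nhi * G * ((Zi * a₀ / Nbar) ^ 2 * ((Λ₁ / K₁) ^ 2 * φ2)))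
    (h2 : (1 - η) * a₀ * M2in ≤ btC * K₁) (h3 : (1 - κ) * γ * φ2 ≤ T) (h4 : γ ≤ 2 * (Nbar * M2in)) (h5 : Λ₁ ≤ 2 * lam0) :
    I ≤ (Real.sqrt (8 * Nhi * G / ((1 - η) ^ 2 * (1 - κ) * M2in * Nbar)) * (btC * Zi / γ * lam0)) ^ 2 * T := by
  have hη1 : 0 < 1 - η := by linarith
  have hκ1 : 0 < 1 - κ := by linarith
  rw [mul_pow, Real.sq_sqrt (by positivity)]
  exact shell_currency hZi ha₀ hNhi hG hN hM hK₁ hφ2 hη hκ hγ hΛ₁ h1 h2 h3 h4 h5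

end Summit.QuantumFields.YangMills.Theorems.FemtoTransferGap.TwoLattice.ConstTube

end
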